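import Literature.Probability.LatticeModels.IsingConsistency
import Literature.Probability.LatticeModels.IsingFKG
import Literature.Probability.LatticeModels.IsingEffectiveField
import Literature.Probability.LatticeModels.GaussianPairingBoundCouplings
import HarnessLib

/-!
# Decorated Ising systems: boundary fields, comparison of two finite-volume systems by FKG,
# the heat-bath identity, and the dedecoration (decoration–iteration) transformation

Topic `Probability/LatticeModels`. General finite-volume identities and inequalities for the
nearest-neighbour Ising model `μ^{bc}_{Λ;β,h}` of `IsingModel` on an arbitrary locally finite graph,
needed for Steps 1–2 of the Griffiths–Pearce–Israel argument of van Enter–Fernández–Sokal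
(J. Stat. Phys. 72 (1993) 879, §4.1.2: "the modified object system is simply a ferromagnetic
Ising model in zero field on a decorated lattice … we can explicitly integrate out the spins in the
decorated lattice that have exactly two neighbors, yielding an effective coupling
`J' = ½ log cosh 2J`"; "by the FKG inequality (or alternatively the Griffiths II inequality), the
local magnetizations … are bounded below by the values that they would take if the magnetic fields
`+2J` in (i) were changed to zero, and the fields `+3J` in (ii) changed to `+J`").

* With `bdryField G Λ η z = ∑_{y ∼ z, y ∉ Λ} η_y`, the field induced at `z ∈ Λ` by a fixed
  boundary condition (`IsingEffectiveField`), the decomposition of the Boltzmann weight into bulk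
  and boundary-field parts (`isingWeight_fixed_eq_exp`; Friedli–Velenik 2017, §3.1 eq. (3.6) and
  §3.8.1, p. 141: "`K_{{i}} = h + β #{j ∉ Λ : j ∼ i}`" for `η ≡ +1`).
* **Comparison of two systems on the same volume** (possibly on different graphs with the same
  edges inside `Λ`, and different boundary conditions): if the induced boundary fields compare
  SITEWISE, `h_b(z) ≤ h_a(z)` for all `z ∈ Λ`, then `⟨f⟩_b ≤ ⟨f⟩_a` for every nondecreasing
  `Λ`-local `f` and `β ≥ 0` (`isingExpect_fixed_le_of_bdryField_le`; the antitone form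
  `isingExpect_fixed_ge_of_bdryField_le`). This is the FKG monotonicity in a site-dependent
  magnetic field (Friedli–Velenik 2017, §3.6.3, proof of Lemma 3.23 and Exercise 3.13: the tilt
  `w_b = w_a · R` with `R` monotone, plus the FKG inequality `ising_fkg_holds`), in the form used by
  van Enter–Fernández–Sokal, where only the TOTAL field at each site matters — the pointwise order
  of boundary conditions (`isingExpect_fixed_mono`) is not available there.
* **The heat-bath (one-site DLR) identity** at zero field: `⟨σ_x g⟩ = ⟨tanh(β ∑_{y∼x} σ_y) g⟩` for
  `g` not depending on `σ_x` (`isingExpect_spinAt_mul_eq_tanh`; Friedli–Velenik 2017, Lemma 6.7 /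
  Exercise 3.11 with the one-site kernel; this is van Enter–Fernández–Sokal's (4.6),
  `⟨σ_{i}⟩ = ⟨tanh(J(σ' + σ''))⟩`).
* **Partition function of an independent set** with frozen surroundings
  (`isingPartitionFunction_fixed_of_independent`: `∏_d 2cosh(β ∑_{y∼d} η_y)`).
* **Dedecoration** (`sum_isingWeight_plus_dedecoration`, `isingExpect_plus_dedecoration`): if the
  volume splits as `φ(Λ') ⊔ D` where the "vertices" `φ(Λ')` only touch "decorations" `D`, the
  decorations are pairwise non-adjacent, and each decoration `d` has exactly the two neighbours
  `φ(a), φ(b)` for an edge `{a,b} = ε(d)` of a graph `G'` on the vertex labels (`ε` a bijection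
  from `D` onto the edges of `G'` touching `Λ'`), then for every observable `F` of the vertex spins
  `⟨F(σ ∘ φ)⟩⁺_{G;Λ;β,0} = ⟨F⟩⁺_{G';Λ';β',0}` with `β' = ½ log cosh 2β`, the tree's `PairIsing.decorK β`
  (`GaussianPairingBoundCouplings`, Fisher's decoration transformation): summing a decoration spin
  gives `∑_{s=±1} e^{βs(σ_a+σ_b)} = 2cosh β(σ_a+σ_b) = 2e^{β'} · e^{β'σ_aσ_b}`
  (`exp_add_exp_neg_spin_sum`, the two-term form of `PairIsing.sum_units_exp_decoration`). (van Enter–Fernández–Sokal 1993, §4.1.2 Step 1 and Fig. 3;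
  Syozi's decoration–iteration transformation, in Domb–Green vol. 1 (1972).)

## References

* A. C. D. van Enter, R. Fernández, A. D. Sokal, J. Stat. Phys. 72 (1993) 879–1167
  (arXiv:hep-lat/9210032), §4.1.2 Steps 1–2, eqs. (4.6), Figs. 3–4 [VanenterFernandezSokal1993].
* S. Friedli, Y. Velenik, *Statistical Mechanics of Lattice Systems* (CUP 2017), §3.1, §3.6.3
  (Lemma 3.23, Exercise 3.13), §3.8.1 (p. 141), Lemma 6.7 [FriedliVelenik2017].
-/

noncomputable section

open MeasureTheory Finset

namespace Literature.Probability.LatticeModels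

/-! ### Comparing two finite-volume systems on the same volume -/

section CrossSystem

variable {V : Type*} [DecidableEq V] {G₁ G₂ : SimpleGraph V} [G₁.LocallyFinite] [G₂.LocallyFinite]

/-- **Expectations of a tilted system.** If the Boltzmann weights of system `2` are those of
system `1` times a factor `C · R(τ·bc₁)` (`C ≠ 0`), then for every observable `f` reading the two
glued configurations identically, `⟨f⟩₂ = ⟨f R⟩₁ / ⟨R⟩₁` (Friedli–Velenik 2017, proof of
Lemma 3.23: `⟨f⟩⁺ = ⟨f I⟩^∅/⟨I⟩^∅`). The two systems may live on different graphs and carry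
different parameters (generalising the tree's `isingExpect_eq_div_of_isingWeight_eq` of
`IsingMonotonicity`, same graph and same outside configuration, and the change-of-boundary-spins
ratio formula `isingExpect_fixed_piecewise_eq_div` of `IsingBoundaryTilt`).
[cite: FriedliVelenik2017, proof of Lemma 3.23] -/
theorem isingExpect_eq_div_of_isingWeight_eq_mul {Λ : Finset V} {β₁ h₁ β₂ h₂ : ℝ}
    {bc₁ bc₂ : BoundaryCondition V} {C : ℝ} (hC : C ≠ 0) {R : SpinConfig V → ℝ}
    (hR : Measurable R)
    (hw : ∀ τ : Λ → ℤˣ, isingWeight G₂ Λ β₂ h₂ bc₂ τ =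
      C * (isingWeight G₁ Λ β₁ h₁ bc₁ τ * R (glue Λ τ bc₁)))
    {f : SpinConfig V → ℝ} (hf : Measurable f)
    (hloc : ∀ τ : Λ → ℤˣ, f (glue Λ τ bc₂) = f (glue Λ τ bc₁)) :
    isingExpect G₂ Λ β₂ h₂ bc₂ f =
      isingExpect G₁ Λ β₁ h₁ bc₁ (fun σ => f σ * R σ) / isingExpect G₁ Λ β₁ h₁ bc₁ R := by
  have hZ₁ := isingPartitionFunction_pos G₁ Λ β₁ h₁ bc₁
  rw [isingExpect_eq_sum_div G₂ Λ h₂ bc₂ β₂ hf,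
    isingExpect_eq_sum_div G₁ Λ h₁ bc₁ β₁ (show Measurable (fun σ => f σ * R σ) from hf.mul hR),
    isingExpect_eq_sum_div G₁ Λ h₁ bc₁ β₁ hR, div_div_div_cancel_right₀ hZ₁.ne']
  have hnum : ∑ τ : Λ → ℤˣ, isingWeight G₂ Λ β₂ h₂ bc₂ τ * f (glue Λ τ bc₂) =
      C * ∑ τ : Λ → ℤˣ, isingWeight G₁ Λ β₁ h₁ bc₁ τ * (f (glue Λ τ bc₁) * R (glue Λ τ bc₁)) := by
    rw [Finset.mul_sum]
    refine Finset.sum_congr rfl fun τ _ => ?_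
    rw [hw τ, hloc τ]
    ring
  have hden : isingPartitionFunction G₂ Λ β₂ h₂ bc₂ =
      C * ∑ τ : Λ → ℤˣ, isingWeight G₁ Λ β₁ h₁ bc₁ τ * R (glue Λ τ bc₁) := by
    simp only [isingPartitionFunction]
    rw [Finset.mul_sum]
    refine Finset.sum_congr rfl fun τ _ => ?_
    rw [hw τ]
  rw [hnum, hden, mul_div_mul_left _ _ hC]

/-- `⟨-f⟩ = -⟨f⟩` for a measurable observable. [folklore] -/
theorem isingExpect_neg_fun (Λ : Finset V) (β h : ℝ) (bc : BoundaryCondition V)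
    {f : SpinConfig V → ℝ} (hf : Measurable f) :
    isingExpect G₁ Λ β h bc (fun σ => -f σ) = -isingExpect G₁ Λ β h bc f := by
  have : (fun σ => -f σ) = fun σ => (-1 : ℝ) * f σ := funext fun σ => by ring
  rw [this, isingExpect_const_mul' G₁ Λ h bc β (-1) hf]
  ring

/-- **FKG comparison of a tilted system, nondecreasing observables.** In the situation of
`isingExpect_eq_div_of_isingWeight_eq_mul` with `β₁ ≥ 0`, `C > 0` and a positive NONINCREASING tilt
`R`, every nondecreasing observable has `⟨f⟩₂ = ⟨fR⟩₁/⟨R⟩₁ ≤ ⟨f⟩₁` by the FKG inequality in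
system `1` (Friedli–Velenik 2017, Lemma 3.23 / Exercise 3.13). [cite: FriedliVelenik2017, Lemma 3.23 and Exercise 3.13] -/
theorem isingExpect_le_of_isingWeight_eq_mul {Λ : Finset V} {β₁ : ℝ} (hβ₁ : 0 ≤ β₁)
    {h₁ β₂ h₂ : ℝ} {bc₁ bc₂ : BoundaryCondition V} {C : ℝ} (hC : 0 < C) {R : SpinConfig V → ℝ}
    (hR : Measurable R) (hRpos : ∀ σ, 0 < R σ) (hRanti : Antitone R)
    (hw : ∀ τ : Λ → ℤˣ, isingWeight G₂ Λ β₂ h₂ bc₂ τ =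
      C * (isingWeight G₁ Λ β₁ h₁ bc₁ τ * R (glue Λ τ bc₁)))
    {f : SpinConfig V → ℝ} (hf : Monotone f) (hfm : Measurable f)
    (hloc : ∀ τ : Λ → ℤˣ, f (glue Λ τ bc₂) = f (glue Λ τ bc₁)) :
    isingExpect G₂ Λ β₂ h₂ bc₂ f ≤ isingExpect G₁ Λ β₁ h₁ bc₁ f := by
  rw [isingExpect_eq_div_of_isingWeight_eq_mul hC.ne' hR hw hfm hloc,
    div_le_iff₀ (isingExpect_pos G₁ Λ β₁ h₁ bc₁ hR hRpos)]
  have hfkg := ising_fkg_holds G₁ hβ₁ Λ h₁ bc₁ f (fun σ => -R σ) hf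
    (fun a b hab => neg_le_neg (hRanti hab)) hfm hR.neg
  have h2 : isingExpect G₁ Λ β₁ h₁ bc₁ (f * fun σ => -R σ) =
      -isingExpect G₁ Λ β₁ h₁ bc₁ (fun σ => f σ * R σ) := by
    rw [← isingExpect_neg_fun Λ β₁ h₁ bc₁ (show Measurable (fun σ => f σ * R σ) from hfm.mul hR)]
    congr 1
    funext σ
    simp only [Pi.mul_apply]
    ring
  rw [isingExpect_neg_fun Λ β₁ h₁ bc₁ hR, h2] at hfkg
  nlinarith [hfkg]

/-- **FKG comparison of a tilted system, nonincreasing observables**: under the same hypotheses,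
`⟨f⟩₁ ≤ ⟨f⟩₂` for every nonincreasing `f`. [cite: FriedliVelenik2017, Lemma 3.23 and Exercise 3.13] -/
theorem isingExpect_ge_of_isingWeight_eq_mul {Λ : Finset V} {β₁ : ℝ} (hβ₁ : 0 ≤ β₁)
    {h₁ β₂ h₂ : ℝ} {bc₁ bc₂ : BoundaryCondition V} {C : ℝ} (hC : 0 < C) {R : SpinConfig V → ℝ}
    (hR : Measurable R) (hRpos : ∀ σ, 0 < R σ) (hRanti : Antitone R)
    (hw : ∀ τ : Λ → ℤˣ, isingWeight G₂ Λ β₂ h₂ bc₂ τ =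
      C * (isingWeight G₁ Λ β₁ h₁ bc₁ τ * R (glue Λ τ bc₁)))
    {f : SpinConfig V → ℝ} (hf : Antitone f) (hfm : Measurable f)
    (hloc : ∀ τ : Λ → ℤˣ, f (glue Λ τ bc₂) = f (glue Λ τ bc₁)) :
    isingExpect G₁ Λ β₁ h₁ bc₁ f ≤ isingExpect G₂ Λ β₂ h₂ bc₂ f := by
  have key := isingExpect_le_of_isingWeight_eq_mul hβ₁ hC hR hRpos hRanti hw
    (f := fun σ => -f σ) (fun a b hab => neg_le_neg (hf hab)) hfm.neg (fun τ => by rw [hloc τ])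
  rw [isingExpect_neg_fun Λ β₂ h₂ bc₂ hfm, isingExpect_neg_fun Λ β₁ h₁ bc₁ hfm] at key
  linarith

end CrossSystem

/-! ### The boundary field of a fixed boundary condition -/

section BdryField

variable {V : Type*} (G : SimpleGraph V) [DecidableEq V] [G.LocallyFinite]

/-- `∑_{e ∈ ℰ^b_Λ} σ_e = ∑_{e ∈ ℰ_Λ} σ_e + ∑_{z ∈ Λ} σ_z ∑_{y ∼ z, y ∉ Λ} σ_y` (bulk plus boundary).
[cite: FriedliVelenik2017, §3.1, eq. (3.6)] -/
theorem sum_edgesTouching_bondSpin_eq (Λ : Finset V) (σ : SpinConfig V) :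
    ∑ e ∈ edgesTouching G Λ, bondSpin σ e =
      ∑ e ∈ edgesIn G Λ, bondSpin σ e +
        ∑ z ∈ Λ, spinAt z σ * ∑ y ∈ outNbrs G Λ z, spinAt y σ := by
  rw [← sum_edgeBoundary_bondSpin, edgeBoundary, add_comm,
    Finset.sum_sdiff (edgesIn_subset_edgesTouching Λ)]

/-- **Bulk × boundary-field decomposition of the Boltzmann weight** of a fixed boundary
condition: `w^η_{Λ;β,h}(τ) = exp β(∑_{e ∈ ℰ_Λ} σ_e + ∑_{z ∈ Λ} σ_z h^η_Λ(z) + h ∑_{z∈Λ} σ_z)`,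
`σ = τ·η`. [cite: FriedliVelenik2017, §3.1 eq. (3.6) and §3.8.1, p. 141] -/
theorem isingWeight_fixed_eq_exp (Λ : Finset V) (β h : ℝ) (η : SpinConfig V) (τ : Λ → ℤˣ) :
    isingWeight G Λ β h (.fixed η) τ =
      Real.exp (β * (∑ e ∈ edgesIn G Λ, bondSpin (glue Λ τ (.fixed η)) e +
        ∑ z ∈ Λ, spinAt z (glue Λ τ (.fixed η)) * bdryField G Λ η z +
        h * ∑ z ∈ Λ, spinAt z (glue Λ τ (.fixed η)))) := by
  rw [isingWeight, isingHamiltonian, interactionEdges_fixed, sum_edgesTouching_bondSpin_eq]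
  have hb : ∀ z ∈ Λ, spinAt z (glue Λ τ (.fixed η)) *
      ∑ y ∈ outNbrs G Λ z, spinAt y (glue Λ τ (.fixed η)) =
        spinAt z (glue Λ τ (.fixed η)) * bdryField G Λ η z := by
    intro z _
    rw [bdryField]
    congr 1
    refine Finset.sum_congr rfl fun y hy => ?_
    simp only [spinAt, glue_apply_of_notMem _ _ _ ((mem_outNbrs G).1 hy).2,
      BoundaryCondition.outside_fixed]
  rw [Finset.sum_congr rfl hb]
  congr 1
  ring

omit [DecidableEq V] [G.LocallyFinite] in
/-- Inside `Λ` the glued configuration does not see the boundary condition. [folklore] -/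
theorem spinAt_glue_fixed_of_mem {Λ : Finset V} (τ : Λ → ℤˣ) (η η' : SpinConfig V) {z : V}
    (hz : z ∈ Λ) : spinAt z (glue Λ τ (.fixed η)) = spinAt z (glue Λ τ (.fixed η')) := by
  simp only [spinAt, glue_apply_of_mem _ _ _ hz]

/-- An edge inside `Λ` does not see the boundary condition. [folklore] -/
theorem bondSpin_glue_fixed_of_mem_edgesIn {G' : SimpleGraph V} [G'.LocallyFinite] {Λ : Finset V}
    (τ : Λ → ℤˣ) (η η' : SpinConfig V) {e : Sym2 V} (he : e ∈ edgesIn G' Λ) :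
    bondSpin (glue Λ τ (.fixed η)) e = bondSpin (glue Λ τ (.fixed η')) e := by
  rw [mem_edgesIn_iff] at he
  induction e using Sym2.ind with
  | _ a b =>
    rw [bondSpin_mk, bondSpin_mk, spinAt_glue_fixed_of_mem τ η η' (he.2 a (Sym2.mem_mk_left a b)),
      spinAt_glue_fixed_of_mem τ η η' (he.2 b (Sym2.mem_mk_right a b))]

/-- **Two systems with the same bulk differ by a boundary-field tilt.** For two graphs with the
same edges inside `Λ` and two boundary conditions, at zero uniform field,
`w_b(τ) = w_a(τ) · exp(β ∑_{z ∈ Λ} (h_b(z) - h_a(z)) σ_z)` with `h_a, h_b` the induced boundary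
fields. [cite: FriedliVelenik2017, proof of Lemma 3.23 and Exercise 3.13] -/
theorem isingWeight_fixed_eq_mul_exp_bdryField {G_a G_b : SimpleGraph V} [G_a.LocallyFinite]
    [G_b.LocallyFinite] {Λ : Finset V} (hin : edgesIn G_a Λ = edgesIn G_b Λ) (β : ℝ)
    (η_a η_b : SpinConfig V) (τ : Λ → ℤˣ) :
    isingWeight G_b Λ β 0 (.fixed η_b) τ =
      isingWeight G_a Λ β 0 (.fixed η_a) τ *
        Real.exp (β * ∑ z ∈ Λ, (bdryField G_b Λ η_b z - bdryField G_a Λ η_a z) *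
          spinAt z (glue Λ τ (.fixed η_a))) := by
  rw [isingWeight_fixed_eq_exp, isingWeight_fixed_eq_exp, ← Real.exp_add, ← hin]
  congr 1
  have h1 : ∑ e ∈ edgesIn G_a Λ, bondSpin (glue Λ τ (.fixed η_b)) e =
      ∑ e ∈ edgesIn G_a Λ, bondSpin (glue Λ τ (.fixed η_a)) e :=
    Finset.sum_congr rfl fun e he => bondSpin_glue_fixed_of_mem_edgesIn τ η_b η_a he
  have h2 : ∑ z ∈ Λ, spinAt z (glue Λ τ (.fixed η_b)) * bdryField G_b Λ η_b z =
      ∑ z ∈ Λ, spinAt z (glue Λ τ (.fixed η_a)) * bdryField G_a Λ η_a z +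
        ∑ z ∈ Λ, (bdryField G_b Λ η_b z - bdryField G_a Λ η_a z) *
          spinAt z (glue Λ τ (.fixed η_a)) := by
    rw [← Finset.sum_add_distrib]
    refine Finset.sum_congr rfl fun z hz => ?_
    rw [spinAt_glue_fixed_of_mem τ η_b η_a hz]
    ring
  rw [h1, h2]
  ring

omit [DecidableEq V] [G.LocallyFinite] in
/-- The boundary-field tilt `exp(β ∑_{z∈Λ} c_z σ_z)` is nonincreasing when `β ≥ 0` and all
`c_z ≤ 0`. [cite: FriedliVelenik2017, Exercise 3.13] -/
theorem antitone_exp_sum_mul_spinAt {Λ : Finset V} {β : ℝ} (hβ : 0 ≤ β) {c : V → ℝ}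
    (hc : ∀ z ∈ Λ, c z ≤ 0) :
    Antitone fun σ : SpinConfig V => Real.exp (β * ∑ z ∈ Λ, c z * spinAt z σ) := by
  intro σ σ' hle
  refine Real.exp_le_exp.2 (mul_le_mul_of_nonneg_left ?_ hβ)
  exact Finset.sum_le_sum fun z hz => mul_le_mul_of_nonpos_left (spinAt_mono z hle) (hc z hz)

omit [DecidableEq V] [G.LocallyFinite] in
/-- The boundary-field tilt is measurable. [folklore] -/
theorem measurable_exp_sum_mul_spinAt (Λ : Finset V) (β : ℝ) (c : V → ℝ) :
    Measurable fun σ : SpinConfig V => Real.exp (β * ∑ z ∈ Λ, c z * spinAt z σ) :=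
  Real.measurable_exp.comp
    ((Finset.measurable_sum _ fun z _ => (measurable_spinAt z).const_mul _).const_mul _)

/-- **Sitewise comparison of boundary fields, nondecreasing observables** (FKG monotonicity in a
site-dependent field, Friedli–Velenik 2017, Lemma 3.23 / Exercise 3.13; the reduction "the
magnetic fields `+2J` in (i) changed to zero, and the fields `+3J` in (ii) changed to `+J`" of van
Enter–Fernández–Sokal 1993, §4.1.2 Step 2). Let two locally finite graphs on `V` have the same
edges inside `Λ`, let `β ≥ 0`, and let the boundary fields induced by `η_b` (graph `G_b`) be
sitewise below those induced by `η_a` (graph `G_a`). Then `⟨f⟩^{η_b}_{G_b;Λ;β,0} ≤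
⟨f⟩^{η_a}_{G_a;Λ;β,0}` for every nondecreasing measurable `f` depending only on the spins in `Λ`.
[cite: FriedliVelenik2017, Lemma 3.23 and Exercise 3.13] [cite: VanenterFernandezSokal1993, §4.1.2 Step 2] -/
theorem isingExpect_fixed_le_of_bdryField_le {G_a G_b : SimpleGraph V} [G_a.LocallyFinite]
    [G_b.LocallyFinite] {Λ : Finset V} (hin : edgesIn G_a Λ = edgesIn G_b Λ) {β : ℝ}
    (hβ : 0 ≤ β) {η_a η_b : SpinConfig V}
    (hfield : ∀ z ∈ Λ, bdryField G_b Λ η_b z ≤ bdryField G_a Λ η_a z)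
    {f : SpinConfig V → ℝ} (hf : Monotone f) (hfm : Measurable f)
    (hloc : ∀ σ σ' : SpinConfig V, (∀ z ∈ Λ, σ z = σ' z) → f σ = f σ') :
    isingExpect G_b Λ β 0 (.fixed η_b) f ≤ isingExpect G_a Λ β 0 (.fixed η_a) f := by
  set c : V → ℝ := fun z => bdryField G_b Λ η_b z - bdryField G_a Λ η_a z with hc
  refine isingExpect_le_of_isingWeight_eq_mul (G₁ := G_a) (G₂ := G_b) hβ one_pos
    (measurable_exp_sum_mul_spinAt Λ β c) (fun σ => Real.exp_pos _)
    (antitone_exp_sum_mul_spinAt hβ fun z hz => by simp only [hc]; linarith [hfield z hz])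
    (fun τ => by rw [one_mul, isingWeight_fixed_eq_mul_exp_bdryField hin β η_a η_b τ])
    hf hfm fun τ => hloc _ _ fun z hz => by
      rw [glue_apply_of_mem _ _ _ hz, glue_apply_of_mem _ _ _ hz]

/-- **Sitewise comparison of boundary fields, nonincreasing observables**: under the same
hypotheses, `⟨f⟩^{η_a}_{G_a;Λ;β,0} ≤ ⟨f⟩^{η_b}_{G_b;Λ;β,0}` for nonincreasing `f`.
[cite: FriedliVelenik2017, Lemma 3.23 and Exercise 3.13] [cite: VanenterFernandezSokal1993, §4.1.2 Step 2] -/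
theorem isingExpect_fixed_ge_of_bdryField_le {G_a G_b : SimpleGraph V} [G_a.LocallyFinite]
    [G_b.LocallyFinite] {Λ : Finset V} (hin : edgesIn G_a Λ = edgesIn G_b Λ) {β : ℝ}
    (hβ : 0 ≤ β) {η_a η_b : SpinConfig V}
    (hfield : ∀ z ∈ Λ, bdryField G_b Λ η_b z ≤ bdryField G_a Λ η_a z)
    {f : SpinConfig V → ℝ} (hf : Antitone f) (hfm : Measurable f)
    (hloc : ∀ σ σ' : SpinConfig V, (∀ z ∈ Λ, σ z = σ' z) → f σ = f σ') :
    isingExpect G_a Λ β 0 (.fixed η_a) f ≤ isingExpect G_b Λ β 0 (.fixed η_b) f := by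
  set c : V → ℝ := fun z => bdryField G_b Λ η_b z - bdryField G_a Λ η_a z with hc
  refine isingExpect_ge_of_isingWeight_eq_mul (G₁ := G_a) (G₂ := G_b) hβ one_pos
    (measurable_exp_sum_mul_spinAt Λ β c) (fun σ => Real.exp_pos _)
    (antitone_exp_sum_mul_spinAt hβ fun z hz => by simp only [hc]; linarith [hfield z hz])
    (fun τ => by rw [one_mul, isingWeight_fixed_eq_mul_exp_bdryField hin β η_a η_b τ])
    hf hfm fun τ => hloc _ _ fun z hz => by
      rw [glue_apply_of_mem _ _ _ hz, glue_apply_of_mem _ _ _ hz]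

end BdryField

/-! ### Configurations of a one-site volume; the heat-bath identity -/

section HeatBath

variable {V : Type*} (G : SimpleGraph V) [DecidableEq V] [G.LocallyFinite]

omit [G.LocallyFinite] in
/-- A sum over the configurations of the one-site volume `{x}` has two terms. [folklore] -/
theorem sum_config_singleton (x : V) (Φ : (↥({x} : Finset V) → ℤˣ) → ℝ) :
    ∑ τ, Φ τ = Φ (fun _ => 1) + Φ (fun _ => -1) := by
  have hconst : ∀ τ : ↥({x} : Finset V) → ℤˣ, (fun _ => τ ⟨x, Finset.mem_singleton_self x⟩) = τ :=
    fun τ => funext fun y => by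
      have hy : y = ⟨x, Finset.mem_singleton_self x⟩ := Subtype.ext (Finset.mem_singleton.1 y.2)
      rw [hy]
  let e : (↥({x} : Finset V) → ℤˣ) ≃ ℤˣ :=
    { toFun := fun τ => τ ⟨x, Finset.mem_singleton_self x⟩
      invFun := fun u _ => u
      left_inv := fun τ => hconst τ
      right_inv := fun _ => rfl }
  rw [← e.symm.sum_comp Φ]
  show ∑ u : ℤˣ, Φ (fun _ => u) = _
  rw [UnitsInt.univ, Finset.sum_pair (by decide)]

omit [G.LocallyFinite] in
/-- Gluing the one-site configuration `τ` on `{x}` into `ξ` updates `ξ` at `x`. [folklore] -/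
theorem glue_singleton_eq_update (x : V) (τ : ↥({x} : Finset V) → ℤˣ) (ξ : SpinConfig V) :
    glue {x} τ (.fixed ξ) = Function.update ξ x (τ ⟨x, Finset.mem_singleton_self x⟩) := by
  funext y
  by_cases hy : y = x
  · subst hy
    rw [glue_apply_of_mem _ _ _ (Finset.mem_singleton_self y), Function.update_self]
  · rw [glue_apply_of_notMem _ _ _ (by simpa using hy), Function.update_of_ne hy]
    rfl

/-- No edge lies inside a one-site volume. [folklore] -/
theorem edgesIn_singleton (x : V) : edgesIn G {x} = ∅ := by
  refine Finset.eq_empty_of_forall_notMem fun e he => ?_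
  rw [mem_edgesIn_iff] at he
  induction e using Sym2.ind with
  | _ a b =>
    have hab : G.Adj a b := (SimpleGraph.mem_edgeSet G).1 he.1
    have ha : a = x := Finset.mem_singleton.1 (he.2 a (Sym2.mem_mk_left a b))
    have hb : b = x := Finset.mem_singleton.1 (he.2 b (Sym2.mem_mk_right a b))
    exact hab.ne (ha.trans hb.symm)

/-- The boundary field of the one-site volume `{x}` is the full neighbour sum `∑_{y ∼ x} ξ_y`.
[folklore] -/
theorem bdryField_singleton (x : V) (ξ : SpinConfig V) :
    bdryField G {x} ξ x = ∑ y ∈ G.neighborFinset x, spinAt y ξ := by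
  rw [bdryField, outNbrs, Finset.filter_true_of_mem]
  intro y hy
  rw [Finset.mem_singleton]
  exact ((SimpleGraph.mem_neighborFinset G x y).1 hy).ne'

/-- **The Boltzmann weight of a single unfrozen spin** at zero field: `w^ξ_{{x};β,0}(u) =
exp(β u ∑_{y∼x} ξ_y)`. [cite: FriedliVelenik2017, §3.1 eq. (3.6)] -/
theorem isingWeight_singleton (x : V) (β : ℝ) (ξ : SpinConfig V) (τ : ↥({x} : Finset V) → ℤˣ) :
    isingWeight G {x} β 0 (.fixed ξ) τ =
      Real.exp (β * ((((τ ⟨x, Finset.mem_singleton_self x⟩ : ℤˣ) : ℤ) : ℝ) *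
        ∑ y ∈ G.neighborFinset x, spinAt y ξ)) := by
  rw [isingWeight_fixed_eq_exp, edgesIn_singleton, Finset.sum_empty, zero_add, zero_mul, add_zero,
    Finset.sum_singleton, bdryField_singleton]
  simp [spinAt]

omit [DecidableEq V] [G.LocallyFinite] in
/-- `tanh t · (e^t + e^{-t}) = e^t - e^{-t}`. [folklore] -/
theorem tanh_mul_exp_add_exp_neg (t : ℝ) :
    Real.tanh t * (Real.exp t + Real.exp (-t)) = Real.exp t - Real.exp (-t) := by
  have hpos : Real.exp t + Real.exp (-t) ≠ 0 := by positivity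
  rw [Real.tanh_eq_sinh_div_cosh, Real.sinh_eq, Real.cosh_eq]
  field_simp

omit [DecidableEq V] [G.LocallyFinite] in
/-- `tanh` is measurable. [folklore] -/
theorem measurable_tanh_comp {f : SpinConfig V → ℝ} (hf : Measurable f) :
    Measurable fun σ => Real.tanh (f σ) := by
  have hc : Continuous fun t : ℝ => Real.tanh t := by
    simp_rw [Real.tanh_eq_sinh_div_cosh]
    exact Real.continuous_sinh.div Real.continuous_cosh fun t => (Real.cosh_pos t).ne'
  exact hc.measurable.comp hf

/-- **The heat-bath (one-site DLR) identity at zero field.** For `x ∈ Λ`, a fixed boundary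
condition and an observable `g` that does not read the spin at `x`,
`⟨σ_x g⟩^η_{Λ;β,0} = ⟨tanh(β ∑_{y∼x} σ_y) · g⟩^η_{Λ;β,0}`: conditionally on all other spins,
`σ_x` has mean `tanh(β ∑_{y∼x} σ_y)` (Friedli–Velenik 2017, Lemma 6.7 / Exercise 3.11, the spatial
Markov property with `Δ = {x}`; van Enter–Fernández–Sokal 1993, eq. (4.6):
"`⟨σ_{i₁,i₂}⟩ = ⟨tanh(J(σ' + σ''))⟩`" for a decoration spin with the two neighbours `σ', σ''`).
[cite: VanenterFernandezSokal1993, §4.1.2 Step 2, eq. (4.6)] [cite: FriedliVelenik2017, Lemma 6.7, eq. (6.5)] -/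
theorem isingExpect_spinAt_mul_eq_tanh {Λ : Finset V} {x : V} (hx : x ∈ Λ) (β : ℝ)
    (η : SpinConfig V) {g : SpinConfig V → ℝ} (hgm : Measurable g)
    (hg : ∀ (σ : SpinConfig V) (u : ℤˣ), g (Function.update σ x u) = g σ) :
    isingExpect G Λ β 0 (.fixed η) (fun σ => spinAt x σ * g σ) =
      isingExpect G Λ β 0 (.fixed η)
        (fun σ => Real.tanh (β * ∑ y ∈ G.neighborFinset x, spinAt y σ) * g σ) := by
  have hsub : ({x} : Finset V) ⊆ Λ := Finset.singleton_subset_iff.2 hx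
  have hm1 : Measurable fun σ : SpinConfig V => spinAt x σ * g σ := (measurable_spinAt x).mul hgm
  have hm2 : Measurable fun σ : SpinConfig V =>
      Real.tanh (β * ∑ y ∈ G.neighborFinset x, spinAt y σ) * g σ :=
    (measurable_tanh_comp ((Finset.measurable_sum _ fun y _ => measurable_spinAt y).const_mul β)).mul
      hgm
  -- the neighbour sum does not read the spin at `x`
  have hM : ∀ (ξ : SpinConfig V) (τ : ↥({x} : Finset V) → ℤˣ),
      ∑ y ∈ G.neighborFinset x, spinAt y (glue {x} τ (.fixed ξ)) =
        ∑ y ∈ G.neighborFinset x, spinAt y ξ := fun ξ τ =>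
    Finset.sum_congr rfl fun y hy => by
      have hyx : y ∉ ({x} : Finset V) := by
        rw [Finset.mem_singleton]
        exact ((SimpleGraph.mem_neighborFinset G x y).1 hy).ne'
      simp only [spinAt, glue_apply_of_notMem _ _ _ hyx, BoundaryCondition.outside_fixed]
  have hgξ : ∀ (ξ : SpinConfig V) (τ : ↥({x} : Finset V) → ℤˣ), g (glue {x} τ (.fixed ξ)) = g ξ :=
    fun ξ τ => by rw [glue_singleton_eq_update, hg]
  have hsx : ∀ (ξ : SpinConfig V) (τ : ↥({x} : Finset V) → ℤˣ),
      spinAt x (glue {x} τ (.fixed ξ)) = (((τ ⟨x, Finset.mem_singleton_self x⟩ : ℤˣ) : ℤ) : ℝ) :=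
    fun ξ τ => by simp [spinAt]
  -- the inner (one-site) sums agree
  have inner : ∀ ξ : SpinConfig V,
      ∑ τ : ↥({x} : Finset V) → ℤˣ, isingWeight G {x} β 0 (.fixed ξ) τ *
          (spinAt x (glue {x} τ (.fixed ξ)) * g (glue {x} τ (.fixed ξ))) =
        ∑ τ : ↥({x} : Finset V) → ℤˣ, isingWeight G {x} β 0 (.fixed ξ) τ *
          (Real.tanh (β * ∑ y ∈ G.neighborFinset x, spinAt y (glue {x} τ (.fixed ξ))) *
            g (glue {x} τ (.fixed ξ))) := by
    intro ξ
    simp_rw [hM, hgξ, hsx, isingWeight_singleton]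
    rw [sum_config_singleton, sum_config_singleton]
    simp only [Units.val_one, Units.val_neg, Int.cast_one, Int.cast_neg, one_mul, neg_mul, mul_neg]
    have key := tanh_mul_exp_add_exp_neg (β * ∑ y ∈ G.neighborFinset x, spinAt y ξ)
    linear_combination (-(g ξ)) * key
  rw [isingExpect_eq_sum_div G Λ 0 _ β hm1, isingExpect_eq_sum_div G Λ 0 _ β hm2]
  congr 1
  rw [sum_isingWeight_fixed_eq_sum_sum G hsub η β 0 (fun σ => spinAt x σ * g σ),
    sum_isingWeight_fixed_eq_sum_sum G hsub η β 0
      (fun σ => Real.tanh (β * ∑ y ∈ G.neighborFinset x, spinAt y σ) * g σ)]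
  refine Finset.sum_congr rfl fun τ₂ _ => ?_
  rw [inner]

omit [DecidableEq V] [G.LocallyFinite] in
/-- `tanh(β(u+v)) = ½ tanh(2β) · (u+v)` for spins `u, v = ±1` (the three values `u + v ∈ {-2,0,2}`;
van Enter–Fernández–Sokal 1993, eq. (4.6): "`⟨tanh(J(σ'+σ''))⟩ = ⟨(½ tanh 2J)(σ'+σ'')⟩`").
[cite: VanenterFernandezSokal1993, §4.1.2 Step 2, eq. (4.6)] -/
theorem tanh_mul_spin_add_spin (β : ℝ) (u v : ℤˣ) :
    Real.tanh (β * (((u : ℤ) : ℝ) + ((v : ℤ) : ℝ))) =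
      Real.tanh (2 * β) / 2 * (((u : ℤ) : ℝ) + ((v : ℤ) : ℝ)) := by
  rcases Int.units_eq_one_or u with rfl | rfl <;> rcases Int.units_eq_one_or v with rfl | rfl <;>
    simp only [Units.val_one, Units.val_neg, Int.cast_one, Int.cast_neg]
  · rw [show β * (1 + 1) = 2 * β by ring]; ring
  · rw [show β * (1 + -1) = 0 by ring, Real.tanh_zero]; ring
  · rw [show β * (-1 + 1) = 0 by ring, Real.tanh_zero]; ring
  · rw [show β * (-1 + -1) = -(2 * β) by ring, Real.tanh_neg]; ring

/-- **van Enter–Fernández–Sokal 1993, eq. (4.6): the magnetisation of a spin with exactly two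
neighbours.** If `d ∈ Λ` has exactly the two neighbours `p ≠ q`, then at zero field
`⟨σ_d⟩^η_{Λ;β,0} = ½ tanh(2β) · (⟨σ_p⟩^η_{Λ;β,0} + ⟨σ_q⟩^η_{Λ;β,0})` ("to compute the magnetization
`⟨σ_{i₁,i₂}⟩` on the internal spins that got integrated out:
`⟨σ_{i₁,i₂}⟩ = ⟨tanh(J(σ'+σ''))⟩ = ⟨(½ tanh 2J)(σ'+σ'')⟩`").
[cite: VanenterFernandezSokal1993, §4.1.2 Step 2, eq. (4.6)] -/
theorem isingExpect_spinAt_eq_of_neighborFinset_eq_pair {Λ : Finset V} {d p q : V} (hd : d ∈ Λ)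
    (hpq : p ≠ q) (hN : G.neighborFinset d = {p, q}) (β : ℝ) (η : SpinConfig V) :
    isingExpect G Λ β 0 (.fixed η) (spinAt d) =
      Real.tanh (2 * β) / 2 *
        (isingExpect G Λ β 0 (.fixed η) (spinAt p) + isingExpect G Λ β 0 (.fixed η) (spinAt q)) := by
  have h1 := isingExpect_spinAt_mul_eq_tanh G hd β η (g := fun _ => (1 : ℝ)) measurable_const
    (fun _ _ => rfl)
  simp only [mul_one, hN] at h1
  have h2 : (fun σ : SpinConfig V => Real.tanh (β * ∑ y ∈ ({p, q} : Finset V), spinAt y σ)) =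
      fun σ => Real.tanh (2 * β) / 2 * (spinAt p σ + spinAt q σ) := by
    funext σ
    rw [Finset.sum_pair hpq]
    exact tanh_mul_spin_add_spin β (σ p) (σ q)
  rw [show (spinAt d : SpinConfig V → ℝ) = fun σ => spinAt d σ from rfl, h1, h2,
    isingExpect_const_mul' G Λ 0 _ β _
      (show Measurable (fun σ => spinAt p σ + spinAt q σ) from
        (measurable_spinAt p).add (measurable_spinAt q)),
    isingExpect_add' G Λ 0 _ β (measurable_spinAt p) (measurable_spinAt q)]

end HeatBath

/-! ### Independent sets of spins with frozen surroundings -/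

section Independent

variable {V : Type*} (G : SimpleGraph V) [DecidableEq V] [G.LocallyFinite]

/-- No edge lies inside an independent set. [folklore] -/
theorem edgesIn_eq_empty_of_independent {D : Finset V} (hDD : ∀ d₁ ∈ D, ∀ d₂ ∈ D, ¬ G.Adj d₁ d₂) :
    edgesIn G D = ∅ := by
  refine Finset.eq_empty_of_forall_notMem fun e he => ?_
  rw [mem_edgesIn_iff] at he
  induction e using Sym2.ind with
  | _ a b =>
    exact hDD a (he.2 a (Sym2.mem_mk_left a b)) b (he.2 b (Sym2.mem_mk_right a b))
      ((SimpleGraph.mem_edgeSet G).1 he.1)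

/-- For a site of an independent set `D`, all neighbours lie outside `D`, so the boundary field is
the full neighbour sum. [folklore] -/
theorem bdryField_eq_of_independent {D : Finset V} (hDD : ∀ d₁ ∈ D, ∀ d₂ ∈ D, ¬ G.Adj d₁ d₂)
    {d : V} (hd : d ∈ D) (η : SpinConfig V) :
    bdryField G D η d = ∑ y ∈ G.neighborFinset d, spinAt y η := by
  rw [bdryField, outNbrs, Finset.filter_true_of_mem]
  intro y hy hyD
  exact hDD d hd y hyD ((SimpleGraph.mem_neighborFinset G d y).1 hy)

/-- **Partition function of an independent set with frozen surroundings** (zero field): the spins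
of `D` do not interact with each other, so
`Z^η_{D;β,0} = ∏_{d ∈ D} (e^{β S_d} + e^{-β S_d})`, `S_d = ∑_{y ∼ d} η_y` ("we can explicitly
integrate out the spins … that have exactly two neighbors", van Enter–Fernández–Sokal 1993, §4.1.2
Step 1). [cite: VanenterFernandezSokal1993, §4.1.2 Step 1] -/
theorem isingPartitionFunction_fixed_of_independent {D : Finset V}
    (hDD : ∀ d₁ ∈ D, ∀ d₂ ∈ D, ¬ G.Adj d₁ d₂) (β : ℝ) (η : SpinConfig V) :
    isingPartitionFunction G D β 0 (.fixed η) =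
      ∏ d ∈ D, (Real.exp (β * ∑ y ∈ G.neighborFinset d, spinAt y η) +
        Real.exp (-(β * ∑ y ∈ G.neighborFinset d, spinAt y η))) := by
  set S : V → ℝ := fun d => ∑ y ∈ G.neighborFinset d, spinAt y η with hS
  have hw : ∀ τ : ↥D → ℤˣ, isingWeight G D β 0 (.fixed η) τ =
      ∏ d : ↥D, Real.exp (β * ((((τ d : ℤˣ) : ℤ) : ℝ) * S d)) := by
    intro τ
    rw [isingWeight_fixed_eq_exp, edgesIn_eq_empty_of_independent G hDD, Finset.sum_empty, zero_add,
      zero_mul, add_zero, Finset.mul_sum, Real.exp_sum, ← Finset.prod_coe_sort D]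
    refine Finset.prod_congr rfl fun d _ => ?_
    rw [bdryField_eq_of_independent G hDD d.2]
    simp [spinAt, hS]
  unfold isingPartitionFunction
  simp_rw [hw]
  rw [← Fintype.prod_sum fun (d : ↥D) (u : ℤˣ) => Real.exp (β * (((u : ℤ) : ℝ) * S d)),
    ← Finset.prod_coe_sort D]
  refine Finset.prod_congr rfl fun d _ => ?_
  rw [show (Finset.univ : Finset ℤˣ) = {1, -1} from UnitsInt.univ, Finset.sum_pair (by decide)]
  simp [hS]

/-- **Summing out one decoration spin**: for spins `u, v = ±1`,
`e^{β(u+v)} + e^{-β(u+v)} = 2 cosh β(u+v) = 2e^{K} · e^{K uv}` with `K = ½ log cosh 2β` (the tree's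
`PairIsing.decorK β`, `e^{2K} = cosh 2β`) — the decoration–iteration (dedecoration) relation
"yielding an effective coupling `J' = ½ log cosh 2J` between those two neighbors"
(van Enter–Fernández–Sokal 1993, §4.1.2 Step 1); the two-term form of the tree's
`PairIsing.sum_units_exp_decoration`. [cite: VanenterFernandezSokal1993, §4.1.2 Step 1] -/
theorem exp_add_exp_neg_spin_sum (β : ℝ) (u v : ℤˣ) :
    Real.exp (β * (((u : ℤ) : ℝ) + ((v : ℤ) : ℝ))) + Real.exp (-(β * (((u : ℤ) : ℝ) + ((v : ℤ) : ℝ)))) =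
      2 * Real.exp (PairIsing.decorK β) *
        Real.exp (PairIsing.decorK β * (((u : ℤ) : ℝ) * ((v : ℤ) : ℝ))) := by
  have hu : ((u : ℤ) : ℝ) = 1 ∨ ((u : ℤ) : ℝ) = -1 := by
    rcases Int.units_eq_one_or u with rfl | rfl <;> simp
  have hv : ((v : ℤ) : ℝ) = 1 ∨ ((v : ℤ) : ℝ) = -1 := by
    rcases Int.units_eq_one_or v with rfl | rfl <;> simp
  have key := PairIsing.sum_units_exp_decoration β hu hv
  rw [UnitsInt.univ, Finset.sum_insert (by decide), Finset.sum_singleton] at key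
  simp only [Units.val_one, Int.cast_one, Units.val_neg, Int.cast_neg, one_mul, neg_one_mul] at key
  rw [show -(β * (((u : ℤ) : ℝ) + ((v : ℤ) : ℝ))) = β * (-((u : ℤ) : ℝ) + -((v : ℤ) : ℝ)) by ring]
  exact key

end Independent

/-! ### Dedecoration -/

section Dedecoration

variable {V V' : Type*} (G : SimpleGraph V) (G' : SimpleGraph V') [DecidableEq V] [DecidableEq V']
  [G.LocallyFinite] [G'.LocallyFinite]

omit [DecidableEq V'] [G'.LocallyFinite] in
/-- **One decoration summed out**: if `d` has exactly the two neighbours `φ a, φ b` where `{a, b}`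
is an edge of `G'`, then `e^{β S_d(η)} + e^{-β S_d(η)} = 2e^{β'} · e^{β' η_{φa} η_{φb}}`,
`β' = PairIsing.decorK β`,
`S_d(η) = ∑_{y ∼ d} η_y`. [cite: VanenterFernandezSokal1993, §4.1.2 Step 1] -/
theorem exp_add_exp_neg_nbrSum_eq (φ : V' ↪ V) {d : V} {e : Sym2 V'} (he : e ∈ G'.edgeSet)
    (hnbr : ∀ y, G.Adj d y ↔ ∃ x ∈ e, φ x = y) (β : ℝ) (η : SpinConfig V) :
    Real.exp (β * ∑ y ∈ G.neighborFinset d, spinAt y η) +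
        Real.exp (-(β * ∑ y ∈ G.neighborFinset d, spinAt y η)) =
      2 * Real.exp (PairIsing.decorK β) * Real.exp (PairIsing.decorK β * bondSpin (η ∘ φ) e) := by
  revert he hnbr
  induction e using Sym2.ind with
  | _ a b =>
    intro he hnbr
    have hab : a ≠ b := ((SimpleGraph.mem_edgeSet G').1 he).ne
    have hN : G.neighborFinset d = {φ a, φ b} := by
      ext y
      rw [SimpleGraph.mem_neighborFinset, hnbr y, Finset.mem_insert, Finset.mem_singleton]
      constructor
      · rintro ⟨x, hx, rfl⟩
        rcases Sym2.mem_iff.1 hx with rfl | rfl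
        · exact Or.inl rfl
        · exact Or.inr rfl
      · rintro (rfl | rfl)
        · exact ⟨a, Sym2.mem_mk_left a b, rfl⟩
        · exact ⟨b, Sym2.mem_mk_right a b, rfl⟩
    rw [hN, Finset.sum_pair (φ.injective.ne hab), bondSpin_mk]
    exact exp_add_exp_neg_spin_sum β (η (φ a)) (η (φ b))

omit [DecidableEq V'] [G'.LocallyFinite] in
/-- Every edge touching the decorated volume `φ(Λ') ∪ D` touches a decoration, when the vertices
`φ(Λ')` have all their neighbours in `D`. [cite: VanenterFernandezSokal1993, §4.1.2 Step 1] -/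
theorem edgesTouching_sdiff_eq_empty_of_forall_adj_mem (φ : V' ↪ V) {Λ' : Finset V'} {D : Finset V}
    (hVD : ∀ x ∈ Λ', ∀ y, G.Adj (φ x) y → y ∈ D) :
    edgesTouching G (Λ'.map φ ∪ D) \ edgesTouching G D = ∅ := by
  refine Finset.sdiff_eq_empty_iff_subset.2 fun e he => ?_
  rw [mem_edgesTouching_iff] at he ⊢
  obtain ⟨he, x, hx, hxe⟩ := he
  refine ⟨he, ?_⟩
  rcases Finset.mem_union.1 hx with hx | hx
  · obtain ⟨x', hx', rfl⟩ := Finset.mem_map.1 hx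
    induction e using Sym2.ind with
    | _ a b =>
      have hadj : G.Adj a b := (SimpleGraph.mem_edgeSet G).1 he
      rcases Sym2.mem_iff.1 hxe with h | h
      · exact ⟨b, hVD x' hx' b (h ▸ hadj), Sym2.mem_mk_right a b⟩
      · exact ⟨a, hVD x' hx' a (h ▸ hadj.symm), Sym2.mem_mk_left a b⟩
  · exact ⟨x, hx, hxe⟩

/-- **Dedecoration at the level of Boltzmann sums** (van Enter–Fernández–Sokal 1993, §4.1.2
Step 1, Figs. 3(b)–(c); the decoration–iteration transformation). Let `φ : V' ↪ V` embed the
vertex labels, `Λ'` a finite set of vertex labels, `D` a finite set of decorations with: no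
`φ x` is a decoration; every neighbour of a vertex `φ x`, `x ∈ Λ'`, is a decoration; decorations
are pairwise non-adjacent; `ε` maps `D` bijectively onto the edges of `G'` touching `Λ'`; and the
neighbours of a decoration `d` are exactly `φ a, φ b` for `ε d = {a, b}`. Then for every `F`,
`∑_τ w⁺_{G;φ(Λ')∪D;β,0}(τ) F((τ·+) ∘ φ) = (2e^{β'})^{|D|} ∑_{τ'} w⁺_{G';Λ';β',0}(τ') F(τ'·+)`
with `β' = ½ log cosh 2β = PairIsing.decorK β`: the decoration spins are summed out one by one
(`exp_add_exp_neg_nbrSum_eq`), leaving the nearest-neighbour Ising weight at coupling `β'` on the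
vertices, with `+` boundary condition (a decoration between a vertex of `Λ'` and a frozen `+`
vertex outside produces the boundary field `β'`, "yielding an effective magnetic field
`h' = ½ log cosh 2J`", Fig. 4(d)–(e)). [cite: VanenterFernandezSokal1993, §4.1.2 Steps 1–2, Figs. 3–4] -/
theorem sum_isingWeight_plus_dedecoration (φ : V' ↪ V) (Λ' : Finset V') (D : Finset V)
    (ε : V → Sym2 V') (hφD : ∀ x, φ x ∉ D) (hVD : ∀ x ∈ Λ', ∀ y, G.Adj (φ x) y → y ∈ D)
    (hDD : ∀ d₁ ∈ D, ∀ d₂ ∈ D, ¬ G.Adj d₁ d₂)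
    (hε : Set.BijOn ε D (edgesTouching G' Λ'))
    (hnbr : ∀ d ∈ D, ∀ y, G.Adj d y ↔ ∃ x ∈ ε d, φ x = y) (β : ℝ) (F : SpinConfig V' → ℝ) :
    ∑ τ : ↥(Λ'.map φ ∪ D) → ℤˣ, isingWeight G (Λ'.map φ ∪ D) β 0 .plus τ *
        F (glue (Λ'.map φ ∪ D) τ .plus ∘ φ) =
      (2 * Real.exp (PairIsing.decorK β)) ^ D.card *
        ∑ τ' : Λ' → ℤˣ, isingWeight G' Λ' (PairIsing.decorK β) 0 .plus τ' * F (glue Λ' τ' .plus) := by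
  classical
  set Λ : Finset V := Λ'.map φ ∪ D with hΛ
  have hD : D ⊆ Λ := Finset.subset_union_right
  have hplus : (BoundaryCondition.plus : BoundaryCondition V) = .fixed 1 := rfl
  have hplus' : (BoundaryCondition.plus : BoundaryCondition V') = .fixed 1 := rfl
  -- membership in `Λ \ D`
  have hmemφ : ∀ x, φ x ∈ Λ \ D ↔ x ∈ Λ' := fun x => by
    rw [Finset.mem_sdiff, hΛ, Finset.mem_union, Finset.mem_map' φ]
    exact ⟨fun h => h.1.resolve_right (hφD x), fun h => ⟨Or.inl h, hφD x⟩⟩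
  -- Step 1: sum over the decorations first
  rw [hplus, sum_isingWeight_fixed_eq_sum_sum G hD 1 β 0 (fun σ => F (σ ∘ φ)),
    edgesTouching_sdiff_eq_empty_of_forall_adj_mem G φ hVD]
  simp only [Finset.sum_empty, zero_mul, add_zero, mul_zero, Real.exp_zero, one_mul]
  -- Step 2: the inner sums
  have hcompφ : ∀ (ξ : SpinConfig V) (τ₁ : ↥D → ℤˣ), glue D τ₁ (.fixed ξ) ∘ φ = ξ ∘ φ :=
    fun ξ τ₁ => funext fun x => by
      simp only [Function.comp_apply, glue_apply_of_notMem _ _ _ (hφD x),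
        BoundaryCondition.outside_fixed]
  have hinner : ∀ ξ : SpinConfig V,
      ∑ τ₁ : ↥D → ℤˣ, isingWeight G D β 0 (.fixed ξ) τ₁ * F (glue D τ₁ (.fixed ξ) ∘ φ) =
        (2 * Real.exp (PairIsing.decorK β)) ^ D.card *
          Real.exp (PairIsing.decorK β * ∑ e ∈ edgesTouching G' Λ', bondSpin (ξ ∘ φ) e) *
            F (ξ ∘ φ) := by
    intro ξ
    simp_rw [hcompφ]
    rw [← Finset.sum_mul]
    congr 1
    rw [show ∑ τ₁ : ↥D → ℤˣ, isingWeight G D β 0 (.fixed ξ) τ₁ =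
        isingPartitionFunction G D β 0 (.fixed ξ) from rfl,
      isingPartitionFunction_fixed_of_independent G hDD β ξ,
      Finset.prod_congr rfl fun d hd => exp_add_exp_neg_nbrSum_eq G G' φ
        (mem_edgesTouching_iff.1 (Finset.mem_coe.1 (hε.mapsTo (Finset.mem_coe.2 hd)))).1
        (hnbr d hd) β ξ,
      Finset.prod_mul_distrib, Finset.prod_const, ← Real.exp_sum, ← Finset.mul_sum,
      Finset.sum_nbij ε (fun d hd => Finset.mem_coe.1 (hε.mapsTo (Finset.mem_coe.2 hd))) hε.injOn
        hε.surjOn (fun _ _ => rfl)]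
  simp_rw [hinner]
  -- Step 3: reindex the vertex configurations by `Λ'`
  rw [Finset.mul_sum]
  let f₀ : ↥Λ' → ↥(Λ \ D) := fun x => ⟨φ x, (hmemφ x).2 x.2⟩
  have hf₀ : Function.Bijective f₀ := by
    constructor
    · intro x y hxy
      exact Subtype.ext (φ.injective (congrArg Subtype.val hxy))
    · intro y
      have hy := Finset.mem_sdiff.1 y.2
      have hy1 : (y : V) ∈ Λ'.map φ ∪ D := hy.1
      obtain ⟨x, hx, hxy⟩ := Finset.mem_map.1 ((Finset.mem_union.1 hy1).resolve_right hy.2)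
      exact ⟨⟨x, hx⟩, Subtype.ext hxy⟩
  let e₀ : ↥Λ' ≃ ↥(Λ \ D) := Equiv.ofBijective f₀ hf₀
  let E : (↥(Λ \ D) → ℤˣ) ≃ (↥Λ' → ℤˣ) := e₀.symm.arrowCongr (Equiv.refl ℤˣ)
  have hE : ∀ τ₂ : ↥(Λ \ D) → ℤˣ, E τ₂ = τ₂ ∘ e₀ := fun τ₂ => by
    funext x
    simp [E, Equiv.arrowCongr_apply]
  have hglue : ∀ τ₂ : ↥(Λ \ D) → ℤˣ,
      glue (Λ \ D) τ₂ (.fixed 1) ∘ φ = glue Λ' (τ₂ ∘ e₀) (.fixed 1) := by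
    intro τ₂
    funext x
    simp only [Function.comp_apply]
    by_cases hx : x ∈ Λ'
    · rw [glue_apply_of_mem _ _ _ ((hmemφ x).2 hx), glue_apply_of_mem _ _ _ hx]
      rfl
    · have hx' : φ x ∉ Λ \ D := fun h => hx ((hmemφ x).1 h)
      rw [glue_apply_of_notMem _ _ _ hx', glue_apply_of_notMem _ _ _ hx]
      rfl
  refine Fintype.sum_equiv E _ _ fun τ₂ => ?_
  rw [hE τ₂, hglue τ₂, hplus', mul_assoc]
  congr 2
  rw [isingWeight, isingHamiltonian, interactionEdges_fixed]
  congr 1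
  ring

omit [DecidableEq V] [DecidableEq V'] [G.LocallyFinite] [G'.LocallyFinite] in
/-- The observable `σ ↦ F(σ ∘ φ)` is measurable when `F` is. [folklore] -/
theorem measurable_comp_embedding (φ : V' ↪ V) {F : SpinConfig V' → ℝ} (hF : Measurable F) :
    Measurable fun σ : SpinConfig V => F (σ ∘ φ) :=
  hF.comp (measurable_pi_lambda _ fun x => measurable_pi_apply (φ x))

/-- **Dedecoration of expectations** (van Enter–Fernández–Sokal 1993, §4.1.2 Steps 1–2: "The result
is an ordinary ferromagnetic Ising model on `ℤ²`, with nearest-neighbor coupling `J'` and zero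
magnetic field"; with `+` image spins on the outer layer, "equivalent to a square lattice … with
nearest-neighbor coupling `J'` and `+` boundary conditions", Fig. 4(e)). Under the hypotheses of
`sum_isingWeight_plus_dedecoration`, for every measurable observable `F` of the vertex spins,
`⟨F(σ ∘ φ)⟩⁺_{G;φ(Λ')∪D;β,0} = ⟨F⟩⁺_{G';Λ';β',0}`, `β' = ½ log cosh 2β` (the tree's `PairIsing.decorK β`).
[cite: VanenterFernandezSokal1993, §4.1.2 Steps 1–2, Figs. 3–4] -/
theorem isingExpect_plus_dedecoration (φ : V' ↪ V) (Λ' : Finset V') (D : Finset V)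
    (ε : V → Sym2 V') (hφD : ∀ x, φ x ∉ D) (hVD : ∀ x ∈ Λ', ∀ y, G.Adj (φ x) y → y ∈ D)
    (hDD : ∀ d₁ ∈ D, ∀ d₂ ∈ D, ¬ G.Adj d₁ d₂)
    (hε : Set.BijOn ε D (edgesTouching G' Λ'))
    (hnbr : ∀ d ∈ D, ∀ y, G.Adj d y ↔ ∃ x ∈ ε d, φ x = y) (β : ℝ) {F : SpinConfig V' → ℝ}
    (hF : Measurable F) :
    isingExpect G (Λ'.map φ ∪ D) β 0 .plus (fun σ => F (σ ∘ φ)) =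
      isingExpect G' Λ' (PairIsing.decorK β) 0 .plus F := by
  have hK : 0 < (2 * Real.exp (PairIsing.decorK β)) ^ D.card :=
    pow_pos (mul_pos two_pos (Real.exp_pos _)) _
  have hnum := sum_isingWeight_plus_dedecoration G G' φ Λ' D ε hφD hVD hDD hε hnbr β F
  have hden := sum_isingWeight_plus_dedecoration G G' φ Λ' D ε hφD hVD hDD hε hnbr β fun _ => 1
  simp only [mul_one] at hden
  rw [isingExpect_eq_sum_div G _ 0 _ β (measurable_comp_embedding φ hF),
    isingExpect_eq_sum_div G' Λ' 0 _ _ hF, isingPartitionFunction, isingPartitionFunction, hnum, hden,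
    mul_div_mul_left _ _ hK.ne']

end Dedecoration

end Literature.Probability.LatticeModels

end
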